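import Mathlib
import HarnessLib
import HarnessLib.Audit
import Summits.Langlands.Statement
import Summits.Langlands.Langlands.Theses.RootDecomp2
import Summits.Langlands.Langlands.Theses.PadicReachabilityCarving
import Summits.Langlands.Langlands.Theses.TranscendenceCarving

/-! # BC3 birth skeleton (AFTER-birth twin: imports the born route file and concludes the ROUTE decl by name) for
`TranscendenceCarving.CompatiblePairTraceIndependence` (LIND, rank 2).  NAMED stubs = genuine sectors of the crux; `CompatiblePairTraceIndependence_of` is kernel-checked (sorries ONLY inside `stub_*`). -/

set_option linter.dupNamespace false
set_option linter.unusedVariables false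

namespace Summit.Langlands.Langlands.Theses.TranscendenceCarving.Birth.CompatiblePairTraceIndependence

open scoped BigOperators Topology Manifold Classical MeasureTheory ProbabilityTheory Matrix InnerProductSpace ComplexConjugate ContinuousMap
open Filter Set Function TopologicalSpace MeasureTheory

/-- EXISTENCE half (Berger 2002: de Rham ⟹ potentially semistable; Fontaine: D_pst is a filtered (φ, N, Gal)-module giving a Weil–Deligne representation; transport along ι is matrix bookkeeping): every irreducible pinned-geometric ρ has at v ∣ ℓ SOME Weil–Deligne representation r through the PINNED datum `fontainePstAdicCompletion v ℓ hv` and a transport rℂ. PRINT [Berger2002 Thm 0.7; FontaineAsterisque223 exp. VIII; tree (F8) `IsFontaineDatum.isWeilDeligneOf_of_isLocallyUnramified` = the unramified locus NOW]; in tree it waits for the datum's pst clauses (D2) off the unramified locus. -/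
theorem stub_pstWD_exists :
    ∀ (K : Type) [Field K] [NumberField K] (n : ℕ), 0 < n → ∀ (ℓ : ℕ) [Fact ℓ.Prime] (ι : PadicAlgCl ℓ ≃+* ℂ) (ρ : Literature.NumberTheory.GaloisRepresentations.FramedGaloisRep K (PadicAlgCl ℓ) n), ρ.toGaloisRep.IsIrreducible → ((∀ᶠ v : IsDedekindDomain.HeightOneSpectrum (NumberField.RingOfIntegers K) in Filter.cofinite, ρ.IsUnramifiedAt v) ∧ ∀ (v : IsDedekindDomain.HeightOneSpectrum (NumberField.RingOfIntegers K)) (hv : ((ℓ : ℕ) : NumberField.RingOfIntegers K) ∈ v.asIdeal), (Literature.NumberTheory.PAdicHodge.fontainePstAdicCompletion v ℓ hv).IsDeRhamFramed (ρ.toLocal v)) → ∀ (v : IsDedekindDomain.HeightOneSpectrum (NumberField.RingOfIntegers K)) (hv : ((ℓ : ℕ) : NumberField.RingOfIntegers K) ∈ v.asIdeal), ∃ (r : Literature.NumberTheory.GaloisRepresentations.WeilDeligneRep (v.adicCompletion K) (PadicAlgCl ℓ) (Fin n → PadicAlgCl ℓ)) (rℂ : Literature.NumberTheory.GaloisRepresentations.WeilDeligneRep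 (v.adicCompletion K) ℂ (Fin n → ℂ)), (Literature.NumberTheory.PAdicHodge.fontainePstAdicCompletion v ℓ hv).IsWeilDeligneOf (ρ.toLocal v) r ∧ r.IsTransportAlong (ι : PadicAlgCl ℓ →+* ℂ) rℂ := by
  sorry

/-- TRACE INDEPENDENCE on the ARTIN LOCUS (both ρ|Γ_K and ρ′|Γ_K of finite image) — the BC5 PLAN-ONLY RUNG: for potentially unramified representations D_pst(ρ|K_v) is ρ|W_{K_v} with N = 0 (Fontaine), the Grothendieck recipe gives ρ′|W_{K_v} with N = 0, and a compatible pair of finite-image representations has ι tr ρ = ι′ tr ρ′ on all of Γ_K (Chebotarev density + Brauer–Nesbitt; both are defined over ℚ̄). PRINT, automorphy-free, and OUTSIDE S's known regime (reciprocity for Artin representations over an unreachable K is the strong Artin conjecture). [SerreAbelianLadic1968 I-2.3; DeligneSerre1974 §8; FontaineAsterisque223 exp. VIII §2] -/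
theorem stub_traces_finiteImage :
    ∀ (K : Type) [Field K] [NumberField K] (n : ℕ), 0 < n → ∀ (ℓ : ℕ) [Fact ℓ.Prime] (ι : PadicAlgCl ℓ ≃+* ℂ) (ρ : Literature.NumberTheory.GaloisRepresentations.FramedGaloisRep K (PadicAlgCl ℓ) n) (ℓ' : ℕ) [Fact ℓ'.Prime] (ι' : PadicAlgCl ℓ' ≃+* ℂ) (ρ' : Literature.NumberTheory.GaloisRepresentations.FramedGaloisRep K (PadicAlgCl ℓ') n), ρ.toGaloisRep.IsIrreducible → ((∀ᶠ v : IsDedekindDomain.HeightOneSpectrum (NumberField.RingOfIntegers K) in Filter.cofinite, ρ.IsUnramifiedAt v) ∧ ∀ (v : IsDedekindDomain.HeightOneSpectrum (NumberField.RingOfIntegers K)) (hv : ((ℓ : ℕ) : NumberField.RingOfIntegers K) ∈ v.asIdeal), (Literature.NumberTheory.PAdicHodge.fontainePstAdicCompletion v ℓ hv).IsDeRhamFramed (ρ.toLocal v)) → ρ'.toGaloisRep.IsIrreducible → ((∀ᶠ v : IsDedekindDomain.HeightOneSpectrum (NumberField.RingOfIntegers K) in Filter.cofinite, ρ'.IsUnramifiedAt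 v) ∧ ∀ (v : IsDedekindDomain.HeightOneSpectrum (NumberField.RingOfIntegers K)) (hv' : ((ℓ' : ℕ) : NumberField.RingOfIntegers K) ∈ v.asIdeal), (Literature.NumberTheory.PAdicHodge.fontainePstAdicCompletion v ℓ' hv').IsDeRhamFramed (ρ'.toLocal v)) → (∀ᶠ v : IsDedekindDomain.HeightOneSpectrum (NumberField.RingOfIntegers K) in Filter.cofinite, ∃ α : Multiset ℂ, ρ.HasFrobCharpolyAt v (Literature.NumberTheory.Automorphic.arithFrobPolyOfSatake ι v.residueCard 1 α) ∧ ρ'.HasFrobCharpolyAt v (Literature.NumberTheory.Automorphic.arithFrobPolyOfSatake ι' v.residueCard 1 α)) → ((Set.range ρ).Finite ∧ (Set.range ρ').Finite) → ∀ (v : IsDedekindDomain.HeightOneSpectrum (NumberField.RingOfIntegers K)) (hv : ((ℓ : ℕ) : NumberField.RingOfIntegers K) ∈ v.asIdeal), ((ℓ' : ℕ) : NumberField.RingOfIntegers K) ∉ v.asIdeal → ∀ (r : Literature.NumberTheory.GaloisRepresentations.WeilDeligneRep (v.adicCompletion K) (PadicAlgCl ℓ) (Fin n → PadicAlgCl ℓ))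 (rℂ : Literature.NumberTheory.GaloisRepresentations.WeilDeligneRep (v.adicCompletion K) ℂ (Fin n → ℂ)), (Literature.NumberTheory.PAdicHodge.fontainePstAdicCompletion v ℓ hv).IsWeilDeligneOf (ρ.toLocal v) r → r.IsTransportAlong (ι : PadicAlgCl ℓ →+* ℂ) rℂ → ∀ (r' : Literature.NumberTheory.GaloisRepresentations.WeilDeligneRep (v.adicCompletion K) (PadicAlgCl ℓ') (Fin n → PadicAlgCl ℓ')) (rℂ' : Literature.NumberTheory.GaloisRepresentations.WeilDeligneRep (v.adicCompletion K) ℂ (Fin n → ℂ)), Literature.NumberTheory.GaloisRepresentations.IsWeilDeligneOfLadic (ρ'.toLocal v).toWeilGroupHom r' → r'.IsTransportAlong (ι' : PadicAlgCl ℓ' →+* ℂ) rℂ' → ∀ w : Literature.NumberTheory.GaloisRepresentations.WeilGroup (v.adicCompletion K), LinearMap.trace ℂ (Fin n → ℂ) (rℂ.ρ w) = LinearMap.trace ℂ (Fin n → ℂ) (rℂ'.ρ w) := by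
  sorry

/-- TRACE INDEPENDENCE OFF the Artin locus = Fontaine's conjecture C_WD (ℓ-independence of the Frobenius-semisimple Weil–Deligne representation INCLUDING ℓ = p) in TRACE currency for an abstract compatible PAIR: PRINT for the cohomology of abelian varieties and curves (p-adic weight–monodromy + Katz–Messing/Coleman–Iovita/T. Saito 2003 incl. ℓ = p; Noot 2013/2017 for AV with extra structure), for algebraic Hecke characters (CFT), OPEN in general (no geometric object attached to an abstract pair; Taylor 2004 Conj. 1.1/1.3, Fontaine 1994 C_WD). IDEA-NEEDED. [Fontaine1994Asterisque223 exp. VIII; TSaito2003 = doi:10.1017/S1474748003000057 (ℓ = p WD of modular forms); Noot2013 = arXiv:1202.5livre? see memo; TaylorGaloisReps2004 = arXiv:math/0212403 §1–2] -/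
theorem stub_traces_infiniteImage :
    ∀ (K : Type) [Field K] [NumberField K] (n : ℕ), 0 < n → ∀ (ℓ : ℕ) [Fact ℓ.Prime] (ι : PadicAlgCl ℓ ≃+* ℂ) (ρ : Literature.NumberTheory.GaloisRepresentations.FramedGaloisRep K (PadicAlgCl ℓ) n) (ℓ' : ℕ) [Fact ℓ'.Prime] (ι' : PadicAlgCl ℓ' ≃+* ℂ) (ρ' : Literature.NumberTheory.GaloisRepresentations.FramedGaloisRep K (PadicAlgCl ℓ') n), ρ.toGaloisRep.IsIrreducible → ((∀ᶠ v : IsDedekindDomain.HeightOneSpectrum (NumberField.RingOfIntegers K) in Filter.cofinite, ρ.IsUnramifiedAt v) ∧ ∀ (v : IsDedekindDomain.HeightOneSpectrum (NumberField.RingOfIntegers K)) (hv : ((ℓ : ℕ) : NumberField.RingOfIntegers K) ∈ v.asIdeal), (Literature.NumberTheory.PAdicHodge.fontainePstAdicCompletion v ℓ hv).IsDeRhamFramed (ρ.toLocal v)) → ρ'.toGaloisRep.IsIrreducible → ((∀ᶠ v : IsDedekindDomain.HeightOneSpectrum (NumberField.RingOfIntegers K) in Filter.cofinite, ρ'.IsUnramifiedAt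 v) ∧ ∀ (v : IsDedekindDomain.HeightOneSpectrum (NumberField.RingOfIntegers K)) (hv' : ((ℓ' : ℕ) : NumberField.RingOfIntegers K) ∈ v.asIdeal), (Literature.NumberTheory.PAdicHodge.fontainePstAdicCompletion v ℓ' hv').IsDeRhamFramed (ρ'.toLocal v)) → (∀ᶠ v : IsDedekindDomain.HeightOneSpectrum (NumberField.RingOfIntegers K) in Filter.cofinite, ∃ α : Multiset ℂ, ρ.HasFrobCharpolyAt v (Literature.NumberTheory.Automorphic.arithFrobPolyOfSatake ι v.residueCard 1 α) ∧ ρ'.HasFrobCharpolyAt v (Literature.NumberTheory.Automorphic.arithFrobPolyOfSatake ι' v.residueCard 1 α)) → ¬ ((Set.range ρ).Finite ∧ (Set.range ρ').Finite) → ∀ (v : IsDedekindDomain.HeightOneSpectrum (NumberField.RingOfIntegers K)) (hv : ((ℓ : ℕ) : NumberField.RingOfIntegers K) ∈ v.asIdeal), ((ℓ' : ℕ) : NumberField.RingOfIntegers K) ∉ v.asIdeal → ∀ (r : Literature.NumberTheory.GaloisRepresentations.WeilDeligneRep (v.adicCompletion K) (PadicAlgCl ℓ) (Fin n → PadicAlgCl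 ℓ)) (rℂ : Literature.NumberTheory.GaloisRepresentations.WeilDeligneRep (v.adicCompletion K) ℂ (Fin n → ℂ)), (Literature.NumberTheory.PAdicHodge.fontainePstAdicCompletion v ℓ hv).IsWeilDeligneOf (ρ.toLocal v) r → r.IsTransportAlong (ι : PadicAlgCl ℓ →+* ℂ) rℂ → ∀ (r' : Literature.NumberTheory.GaloisRepresentations.WeilDeligneRep (v.adicCompletion K) (PadicAlgCl ℓ') (Fin n → PadicAlgCl ℓ')) (rℂ' : Literature.NumberTheory.GaloisRepresentations.WeilDeligneRep (v.adicCompletion K) ℂ (Fin n → ℂ)), Literature.NumberTheory.GaloisRepresentations.IsWeilDeligneOfLadic (ρ'.toLocal v).toWeilGroupHom r' → r'.IsTransportAlong (ι' : PadicAlgCl ℓ' →+* ℂ) rℂ' → ∀ w : Literature.NumberTheory.GaloisRepresentations.WeilGroup (v.adicCompletion K), LinearMap.trace ℂ (Fin n → ℂ) (rℂ.ρ w) = LinearMap.trace ℂ (Fin n → ℂ) (rℂ'.ρ w) := by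
  sorry

/-- LIND from the three stubs (kernel-checked, no sorry): existence of the pst-side pair, then the trace identity by cases on «both images finite». -/
theorem CompatiblePairTraceIndependence_of
    (hex : ∀ (K : Type) [Field K] [NumberField K] (n : ℕ), 0 < n → ∀ (ℓ : ℕ) [Fact ℓ.Prime] (ι : PadicAlgCl ℓ ≃+* ℂ) (ρ : Literature.NumberTheory.GaloisRepresentations.FramedGaloisRep K (PadicAlgCl ℓ) n), ρ.toGaloisRep.IsIrreducible → ((∀ᶠ v : IsDedekindDomain.HeightOneSpectrum (NumberField.RingOfIntegers K) in Filter.cofinite, ρ.IsUnramifiedAt v) ∧ ∀ (v : IsDedekindDomain.HeightOneSpectrum (NumberField.RingOfIntegers K)) (hv : ((ℓ : ℕ) : NumberField.RingOfIntegers K) ∈ v.asIdeal), (Literature.NumberTheory.PAdicHodge.fontainePstAdicCompletion v ℓ hv).IsDeRhamFramed (ρ.toLocal v)) → ∀ (v : IsDedekindDomain.HeightOneSpectrum (NumberField.RingOfIntegers K)) (hv : ((ℓ : ℕ) : NumberField.RingOfIntegers K) ∈ v.asIdeal), ∃ (r : Literature.NumberTheory.GaloisRepresentations.WeilDeligneRep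 (v.adicCompletion K) (PadicAlgCl ℓ) (Fin n → PadicAlgCl ℓ)) (rℂ : Literature.NumberTheory.GaloisRepresentations.WeilDeligneRep (v.adicCompletion K) ℂ (Fin n → ℂ)), (Literature.NumberTheory.PAdicHodge.fontainePstAdicCompletion v ℓ hv).IsWeilDeligneOf (ρ.toLocal v) r ∧ r.IsTransportAlong (ι : PadicAlgCl ℓ →+* ℂ) rℂ)
    (hfin : ∀ (K : Type) [Field K] [NumberField K] (n : ℕ), 0 < n → ∀ (ℓ : ℕ) [Fact ℓ.Prime] (ι : PadicAlgCl ℓ ≃+* ℂ) (ρ : Literature.NumberTheory.GaloisRepresentations.FramedGaloisRep K (PadicAlgCl ℓ) n) (ℓ' : ℕ) [Fact ℓ'.Prime] (ι' : PadicAlgCl ℓ' ≃+* ℂ) (ρ' : Literature.NumberTheory.GaloisRepresentations.FramedGaloisRep K (PadicAlgCl ℓ') n), ρ.toGaloisRep.IsIrreducible → ((∀ᶠ v : IsDedekindDomain.HeightOneSpectrum (NumberField.RingOfIntegers K) in Filter.cofinite, ρ.IsUnramifiedAt v) ∧ ∀ (v : IsDedekindDomain.HeightOneSpectrum (NumberField.RingOfIntegers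 K)) (hv : ((ℓ : ℕ) : NumberField.RingOfIntegers K) ∈ v.asIdeal), (Literature.NumberTheory.PAdicHodge.fontainePstAdicCompletion v ℓ hv).IsDeRhamFramed (ρ.toLocal v)) → ρ'.toGaloisRep.IsIrreducible → ((∀ᶠ v : IsDedekindDomain.HeightOneSpectrum (NumberField.RingOfIntegers K) in Filter.cofinite, ρ'.IsUnramifiedAt v) ∧ ∀ (v : IsDedekindDomain.HeightOneSpectrum (NumberField.RingOfIntegers K)) (hv' : ((ℓ' : ℕ) : NumberField.RingOfIntegers K) ∈ v.asIdeal), (Literature.NumberTheory.PAdicHodge.fontainePstAdicCompletion v ℓ' hv').IsDeRhamFramed (ρ'.toLocal v)) → (∀ᶠ v : IsDedekindDomain.HeightOneSpectrum (NumberField.RingOfIntegers K) in Filter.cofinite, ∃ α : Multiset ℂ, ρ.HasFrobCharpolyAt v (Literature.NumberTheory.Automorphic.arithFrobPolyOfSatake ι v.residueCard 1 α) ∧ ρ'.HasFrobCharpolyAt v (Literature.NumberTheory.Automorphic.arithFrobPolyOfSatake ι' v.residueCard 1 α)) → ((Set.range ρ).Finite ∧ (Set.range ρ').Finite) → ∀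 (v : IsDedekindDomain.HeightOneSpectrum (NumberField.RingOfIntegers K)) (hv : ((ℓ : ℕ) : NumberField.RingOfIntegers K) ∈ v.asIdeal), ((ℓ' : ℕ) : NumberField.RingOfIntegers K) ∉ v.asIdeal → ∀ (r : Literature.NumberTheory.GaloisRepresentations.WeilDeligneRep (v.adicCompletion K) (PadicAlgCl ℓ) (Fin n → PadicAlgCl ℓ)) (rℂ : Literature.NumberTheory.GaloisRepresentations.WeilDeligneRep (v.adicCompletion K) ℂ (Fin n → ℂ)), (Literature.NumberTheory.PAdicHodge.fontainePstAdicCompletion v ℓ hv).IsWeilDeligneOf (ρ.toLocal v) r → r.IsTransportAlong (ι : PadicAlgCl ℓ →+* ℂ) rℂ → ∀ (r' : Literature.NumberTheory.GaloisRepresentations.WeilDeligneRep (v.adicCompletion K) (PadicAlgCl ℓ') (Fin n → PadicAlgCl ℓ')) (rℂ' : Literature.NumberTheory.GaloisRepresentations.WeilDeligneRep (v.adicCompletion K) ℂ (Fin n → ℂ)), Literature.NumberTheory.GaloisRepresentations.IsWeilDeligneOfLadic (ρ'.toLocal v).toWeilGroupHom r' → r'.IsTransportAlong (ι' : PadicAlgCl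 ℓ' →+* ℂ) rℂ' → ∀ w : Literature.NumberTheory.GaloisRepresentations.WeilGroup (v.adicCompletion K), LinearMap.trace ℂ (Fin n → ℂ) (rℂ.ρ w) = LinearMap.trace ℂ (Fin n → ℂ) (rℂ'.ρ w))
    (hinf : ∀ (K : Type) [Field K] [NumberField K] (n : ℕ), 0 < n → ∀ (ℓ : ℕ) [Fact ℓ.Prime] (ι : PadicAlgCl ℓ ≃+* ℂ) (ρ : Literature.NumberTheory.GaloisRepresentations.FramedGaloisRep K (PadicAlgCl ℓ) n) (ℓ' : ℕ) [Fact ℓ'.Prime] (ι' : PadicAlgCl ℓ' ≃+* ℂ) (ρ' : Literature.NumberTheory.GaloisRepresentations.FramedGaloisRep K (PadicAlgCl ℓ') n), ρ.toGaloisRep.IsIrreducible → ((∀ᶠ v : IsDedekindDomain.HeightOneSpectrum (NumberField.RingOfIntegers K) in Filter.cofinite, ρ.IsUnramifiedAt v) ∧ ∀ (v : IsDedekindDomain.HeightOneSpectrum (NumberField.RingOfIntegers K)) (hv : ((ℓ : ℕ) : NumberField.RingOfIntegers K) ∈ v.asIdeal), (Literature.NumberTheory.PAdicHodge.fontainePstAdicCompletion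 v ℓ hv).IsDeRhamFramed (ρ.toLocal v)) → ρ'.toGaloisRep.IsIrreducible → ((∀ᶠ v : IsDedekindDomain.HeightOneSpectrum (NumberField.RingOfIntegers K) in Filter.cofinite, ρ'.IsUnramifiedAt v) ∧ ∀ (v : IsDedekindDomain.HeightOneSpectrum (NumberField.RingOfIntegers K)) (hv' : ((ℓ' : ℕ) : NumberField.RingOfIntegers K) ∈ v.asIdeal), (Literature.NumberTheory.PAdicHodge.fontainePstAdicCompletion v ℓ' hv').IsDeRhamFramed (ρ'.toLocal v)) → (∀ᶠ v : IsDedekindDomain.HeightOneSpectrum (NumberField.RingOfIntegers K) in Filter.cofinite, ∃ α : Multiset ℂ, ρ.HasFrobCharpolyAt v (Literature.NumberTheory.Automorphic.arithFrobPolyOfSatake ι v.residueCard 1 α) ∧ ρ'.HasFrobCharpolyAt v (Literature.NumberTheory.Automorphic.arithFrobPolyOfSatake ι' v.residueCard 1 α)) → ¬ ((Set.range ρ).Finite ∧ (Set.range ρ').Finite) → ∀ (v : IsDedekindDomain.HeightOneSpectrum (NumberField.RingOfIntegers K)) (hv : ((ℓ : ℕ) : NumberField.RingOfIntegers K) ∈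 v.asIdeal), ((ℓ' : ℕ) : NumberField.RingOfIntegers K) ∉ v.asIdeal → ∀ (r : Literature.NumberTheory.GaloisRepresentations.WeilDeligneRep (v.adicCompletion K) (PadicAlgCl ℓ) (Fin n → PadicAlgCl ℓ)) (rℂ : Literature.NumberTheory.GaloisRepresentations.WeilDeligneRep (v.adicCompletion K) ℂ (Fin n → ℂ)), (Literature.NumberTheory.PAdicHodge.fontainePstAdicCompletion v ℓ hv).IsWeilDeligneOf (ρ.toLocal v) r → r.IsTransportAlong (ι : PadicAlgCl ℓ →+* ℂ) rℂ → ∀ (r' : Literature.NumberTheory.GaloisRepresentations.WeilDeligneRep (v.adicCompletion K) (PadicAlgCl ℓ') (Fin n → PadicAlgCl ℓ')) (rℂ' : Literature.NumberTheory.GaloisRepresentations.WeilDeligneRep (v.adicCompletion K) ℂ (Fin n → ℂ)), Literature.NumberTheory.GaloisRepresentations.IsWeilDeligneOfLadic (ρ'.toLocal v).toWeilGroupHom r' → r'.IsTransportAlong (ι' : PadicAlgCl ℓ' →+* ℂ) rℂ' → ∀ w : Literature.NumberTheory.GaloisRepresentations.WeilGroup (v.adicCompletion K), LinearMap.trace ℂ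 (Fin n → ℂ) (rℂ.ρ w) = LinearMap.trace ℂ (Fin n → ℂ) (rℂ'.ρ w)) :
    Summit.Langlands.Langlands.Theses.TranscendenceCarving.CompatiblePairTraceIndependence := by
  intro K _ _ n hn ℓ _ ι ρ ℓ' _ ι' ρ' hirr hgeo hirr' hgeo' hcomp v hv hℓ'v r' rℂ' hr' htr'
  obtain ⟨r, rℂ, hpst, htr⟩ := hex K n hn ℓ ι ρ hirr hgeo v hv
  refine ⟨r, rℂ, hpst, htr, ?_⟩
  by_cases hF : ((Set.range ρ).Finite ∧ (Set.range ρ').Finite)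
  · exact hfin K n hn ℓ ι ρ ℓ' ι' ρ' hirr hgeo hirr' hgeo' hcomp hF v hv hℓ'v r rℂ hpst htr r' rℂ' hr' htr'
  · exact hinf K n hn ℓ ι ρ ℓ' ι' ρ' hirr hgeo hirr' hgeo' hcomp hF v hv hℓ'v r rℂ hpst htr r' rℂ' hr' htr'

theorem CompatiblePairTraceIndependence_of_stubs : Summit.Langlands.Langlands.Theses.TranscendenceCarving.CompatiblePairTraceIndependence := CompatiblePairTraceIndependence_of stub_pstWD_exists stub_traces_finiteImage stub_traces_infiniteImage

end Summit.Langlands.Langlands.Theses.TranscendenceCarving.Birth.CompatiblePairTraceIndependence
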